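import Mathlib
import Literature.Computability.AlgebraicComplexity.MatrixMultiplicationExponent
import Literature.Computability.AlgebraicComplexity.BorderRankCW
import Literature.Computability.AlgebraicComplexity.DegenerationSpectralMonotone
import Summits.MatrixMultiplication.MatrixMultiplication.Theorems.LittleCwSliceDeterminants

/-!
# The little Coppersmith–Winograd tensor `cw_{m²-1}` is not a degeneration of `⟨m,m,m⟩`

Topic `Summits/MatrixMultiplication/MatrixMultiplication/Theorems` (supports the aside item
`FarEdgeDescent.LittleCwFlat`, census ask K-cw8 of the decomp-mm tree).

**Theorem** (`cwTensor_not_algDegeneratesTo_matMul`). For `m ≥ 2` and `q + 1 = m²`, the little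
Coppersmith–Winograd tensor `cw_q ∈ ℂ^{q+1} ⊗ ℂ^{q+1} ⊗ ℂ^{q+1}` (`cwTensor ℂ q`) is **not** an
algebraic degeneration (`AlgDegeneratesTo`, BCS (15.19)) of the matrix multiplication tensor
`⟨m,m,m⟩` (`matMulTensor ℂ m m m`), although both have the same format `m² × m² × m²` and both
are `1`-generic. In particular (`cw8_not_algDegeneratesTo_matMul3`) `cw₈ ⋬ ⟨3,3,3⟩`, which decides
the census question K-cw8 ("does `⟨3,3,3⟩` degenerate to `cw₈`?") in the NEGATIVE: the hypothesis
of `FarEdgeDescentCwRecut.recut_iff_of_cw8_degeneration` is unsatisfiable, so the exact-format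
route to `R̃(cw₈) ≤ 9` via matrix multiplication is closed (the asymptotic question
`LittleCwFlat` itself is untouched).

**Invariant (slice-determinant hypersurface).** Contract the third factor of a tensor
`t ∈ K^N ⊗ K^N ⊗ K^N` against a weight vector `ℓ` and take the determinant of the resulting
`N × N` matrix. For `⟨m,m,m⟩` (`N = m²`) the contracted matrix is `1 ⊗ₖ Yᵀ`, so its determinant is
`det(Y)^m` — an `m`-th power (`LittleCwSliceDeterminants.det_matMul_sliceC`). A degeneration
`(A(ε) ⊗ B(ε) ⊗ C(ε)) ⟨m,m,m⟩ = ε^h cw_q + O(ε^{h+1})` transports this: working in `ℂ[t][ε]` with the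
weight line `ℓ(t) = (1, 1+t, i t, 0, …, 0)`, the trailing `ε`-coefficient of the contracted
determinant is on the one hand `det W(t)` for the contracted `cw_q`-matrix `W(t)`, which is
`-(1+2t)` (two row operations make `W` lower triangular,
`LittleCwSliceDeterminants.det_cw_sliceC_line`), and on the other hand
`r · p(t)^m` with `r ∈ ℂˣ` and `p` the trailing coefficient of `det Y(t,ε)` (trailing coefficients are
multiplicative over a domain). Comparing `t`-degrees gives `1 = m · deg p`, impossible for `m ≥ 2`.
Informally: the slice-determinant hypersurface of anything in the orbit closure of `⟨m,m,m⟩` is an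
`m`-fold hypersurface (or everything), whereas that of `cw_q` is `x₀^{q-1} · (x₁² + ⋯ + x_q²)`, which
has a reduced component.

References: the `1_A`-genericity / determinantal equations for degenerations of matrix
multiplication, Landsberg, *Geometry and Complexity Theory* (2017), §5.1; the variety of
degenerations of `⟨m,m,m⟩`, Conner–Gesmundo–Landsberg–Ventura–Wang, arXiv:1811.05511, Thm. 1.8;
degeneration order calculus, Bürgisser–Clausen–Shokrollahi (1997), (15.19)–(15.26). No source
deciding `cw_q ⊴ ⟨m,m,m⟩` was found (searches recorded in the seat notes); the argument here is
elementary and self-contained.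
-/

namespace Summit.MatrixMultiplication.MatrixMultiplication.Theorems.LittleCwNotMatMulDegeneration

open Polynomial Matrix Finset
open scoped Kronecker
open Literature.Computability.AlgebraicComplexity
open Summit.MatrixMultiplication.MatrixMultiplication.Theorems.LittleCwSliceDeterminants

noncomputable section

section Main

-- The ring `ℂ[X][X] = ℂ[t][ε]`: inner variable `t` (the weight line), outer variable `ε`
-- (the degeneration parameter).

/-- **`cw_{m²-1}` is not a degeneration of `⟨m,m,m⟩`** (`m ≥ 2`): no polynomial matrices
`A(ε), B(ε), C(ε) ∈ ℂ[ε]^{m² × m²}` and order `h` satisfy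
`(A(ε) ⊗ B(ε) ⊗ C(ε)) ⟨m,m,m⟩ = ε^h cw_{m²-1} + O(ε^{h+1})`. Proof: slice-determinant invariant
(module docstring). [this file; background Landsberg 2017 §5.1, arXiv:1811.05511 Thm. 1.8] -/
theorem cwTensor_not_algDegeneratesTo_matMul (m q : ℕ) (hm : 2 ≤ m) (hq : q + 1 = m * m) :
    ¬ AlgDegeneratesTo (matMulTensor ℂ m m m) (cwTensor ℂ q) := by
  classical
  rintro ⟨h, A, B, Cc, hABC⟩
  have hq2 : 2 ≤ q := by nlinarith
  -- Step 1: each entry of `(A ⊗ B ⊗ C) ⟨m,m,m⟩` is `ε^h · G'` with `G'(0) = cw_q`.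
  have hdiv : ∀ a' b' c', ∃ G' : ℂ[X],
      (∑ a, ∑ b, ∑ c, A a' a * B b' b * Cc c' c * Polynomial.C (matMulTensor ℂ m m m a b c)) =
        X ^ h * G' ∧ G'.coeff 0 = cwTensor ℂ q a' b' c' := by
    intro a' b' c'
    obtain ⟨G', hG'⟩ : X ^ h ∣
        (∑ a, ∑ b, ∑ c, A a' a * B b' b * Cc c' c * Polynomial.C (matMulTensor ℂ m m m a b c)) := by
      rw [X_pow_dvd_iff]
      intro d hd
      simpa [hd.ne] using hABC a' b' c' d hd.le
    refine ⟨G', hG', ?_⟩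
    have key := hABC a' b' c' h le_rfl
    rw [if_pos rfl, hG', coeff_X_pow_mul'] at key
    simpa using key
  choose G' hG'eq hG'0 using hdiv
  -- Step 2: pass to `ℂ[t][ε]` and contract the third index against the weight line `ℓ(t)`.
  let φ : ℂ[X] →+* ℂ[X][X] := Polynomial.mapRingHom (Polynomial.C : ℂ →+* ℂ[X])
  have hφX : φ X = X := by simp [φ]
  have hφmm : ∀ a b c, φ (Polynomial.C (matMulTensor ℂ m m m a b c)) = matMulTensor ℂ[X][X] m m m a b c := by
    intro a b c
    unfold matMulTensor
    split_ifs <;> simp [φ]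
  have hCcw : ∀ a b c, Polynomial.C (cwTensor ℂ q a b c) = cwTensor ℂ[X] q a b c := by
    intro a b c
    unfold cwTensor
    split_ifs <;> simp
  let ℓ : Fin (q + 1) → ℂ[X] := fun j =>
    if j.val = 0 then 1 else if j.val = 1 then X + 1 else if j.val = 2 then C Complex.I * X else 0
  have hℓ : ∀ j, ℓ j = if j.val = 0 then 1 else if j.val = 1 then X + 1
      else if j.val = 2 then C Complex.I * X else 0 := fun j => rfl
  let N : Matrix (Fin (q + 1)) (Fin (q + 1)) ℂ[X][X] := Matrix.of fun a' b' =>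
    ∑ c', Polynomial.C (ℓ c') * ∑ a, ∑ b, ∑ c,
      φ (A a' a) * φ (B b' b) * φ (Cc c' c) * matMulTensor ℂ[X][X] m m m a b c
  let N' : Matrix (Fin (q + 1)) (Fin (q + 1)) ℂ[X][X] := Matrix.of fun a' b' =>
    ∑ c', Polynomial.C (ℓ c') * φ (G' a' b' c')
  have hφG : ∀ a' b' c', (∑ a, ∑ b, ∑ c,
      φ (A a' a) * φ (B b' b) * φ (Cc c' c) * matMulTensor ℂ[X][X] m m m a b c) =
      φ (∑ a, ∑ b, ∑ c, A a' a * B b' b * Cc c' c * Polynomial.C (matMulTensor ℂ m m m a b c)) := by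
    intro a' b' c'
    simp only [map_sum, map_mul, hφmm]
  have hNN' : N = (X : ℂ[X][X]) ^ h • N' := by
    ext a' b' : 1
    simp only [N, N', Matrix.of_apply, Matrix.smul_apply, smul_eq_mul, hφG, hG'eq, map_mul,
      map_pow, hφX, Finset.mul_sum]
    refine Finset.sum_congr rfl fun c' _ => ?_
    ring
  -- the constant (`ε⁰`) coefficient of `N'` is the contracted `cw_q`-matrix `W(t)`
  set W : Matrix (Fin (q + 1)) (Fin (q + 1)) ℂ[X] :=
    Matrix.of fun a b : Fin (q + 1) => ∑ c, ℓ c * cwTensor ℂ[X] q a b c with hW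
  have hN'0 : N'.map (Polynomial.constantCoeff : ℂ[X][X] →+* ℂ[X]) = W := by
    rw [hW]
    ext a' b' : 1
    simp only [Matrix.map_apply, Matrix.of_apply, N', map_sum, map_mul]
    refine Finset.sum_congr rfl fun c' _ => ?_
    rw [constantCoeff_apply, constantCoeff_apply, coeff_C_zero]
    congr 1
    simp only [φ, Polynomial.coe_mapRingHom, Polynomial.coeff_map, hG'0, hCcw]
  have hdetN'0 : Polynomial.constantCoeff N'.det = W.det := by
    rw [RingHom.map_det, RingHom.mapMatrix_apply, hN'0]
  -- Step 3: factor `N = A♭ · S · B♭ᵀ` and compute `det N` in two ways.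
  have hcard : Fintype.card (Fin m × Fin m) = q + 1 := by
    simp [Fintype.card_prod, Fintype.card_fin, hq]
  let e : Fin (q + 1) ≃ Fin m × Fin m := (Fintype.equivFinOfCardEq hcard).symm
  let y : Fin m × Fin m → ℂ[X][X] := fun c => ∑ c', Polynomial.C (ℓ c') * φ (Cc c' c)
  let S : Matrix (Fin m × Fin m) (Fin m × Fin m) ℂ[X][X] :=
    Matrix.of fun a b => ∑ c, y c * matMulTensor ℂ[X][X] m m m a b c
  let A₀ : Matrix (Fin (q + 1)) (Fin (q + 1)) ℂ[X] := Matrix.of fun i j => A i (e j)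
  let B₀ : Matrix (Fin (q + 1)) (Fin (q + 1)) ℂ[X] := Matrix.of fun i j => B i (e j)
  have hA : (Matrix.of fun i j => φ (A i (e j))) = φ.mapMatrix A₀ := by
    ext i j : 1; simp [A₀]
  have hB : (Matrix.of fun i j => φ (B i (e j))) = φ.mapMatrix B₀ := by
    ext i j : 1; simp [B₀]
  have hNfac : N = Matrix.of (fun i j => φ (A i (e j))) * S.submatrix e e *
      (Matrix.of fun i j => φ (B i (e j)))ᵀ :=
    contract_eq_mul e (fun i a => φ (A i a)) (fun i b => φ (B i b)) (fun c' => Polynomial.C (ℓ c'))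
      (fun c' c => φ (Cc c' c)) (matMulTensor ℂ[X][X] m m m)
  set Yd : ℂ[X][X] := (Matrix.of fun ν μ : Fin m => y (μ, ν)).det with hYd
  set c₀ : ℂ[X] := A₀.det * B₀.det with hc₀
  have hdetN : N.det = φ c₀ * Yd ^ m := by
    rw [hNfac, Matrix.det_mul, Matrix.det_mul, Matrix.det_transpose, Matrix.det_submatrix_equiv_self,
      hA, hB, ← RingHom.map_det, ← RingHom.map_det, hc₀, map_mul]
    simp only [S]
    rw [det_matMul_sliceC]
    ring
  have hdetN2 : N.det = (X : ℂ[X][X]) ^ (h * (q + 1)) * N'.det := by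
    rw [hNN', Matrix.det_smul, Fintype.card_fin, ← pow_mul]
  -- Step 4: trailing `ε`-coefficients.
  have hWdeg : W.det.natDegree = 1 := by
    rw [hW]
    exact natDegree_det_cw_sliceC_lineI q hq2 ℓ hℓ
  have hWne : W.det ≠ 0 := by
    intro h0
    rw [h0, natDegree_zero] at hWdeg
    exact zero_ne_one hWdeg
  have hN'ne : N'.det ≠ 0 := by
    intro h0
    apply hWne
    rw [← hdetN'0, h0, map_zero]
  have htrailN' : N'.det.trailingCoeff = W.det := by
    have h0 : N'.det.coeff 0 ≠ 0 := by
      rwa [← constantCoeff_apply, hdetN'0]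
    rw [trailingCoeff_eq_coeff_zero h0, ← constantCoeff_apply, hdetN'0]
  have hNne : N.det ≠ 0 := by
    rw [hdetN2]
    exact mul_ne_zero (pow_ne_zero _ X_ne_zero) hN'ne
  have htrailN : N.det.trailingCoeff = W.det := by
    rw [hdetN2, trailingCoeff_X_pow_mul, htrailN']
  have hφc₀ : φ c₀ ≠ 0 := by
    intro h0
    apply hNne
    rw [hdetN, h0, zero_mul]
  set r : ℂ := c₀.coeff (φ c₀).natTrailingDegree with hr
  have htrailφ : (φ c₀).trailingCoeff = Polynomial.C r := by
    rw [trailingCoeff, hr]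
    simp [φ, Polynomial.coeff_map]
  have hr0 : r ≠ 0 := by
    intro h0
    apply trailingCoeff_nonzero_iff_nonzero.mpr hφc₀
    rw [htrailφ, h0, map_zero]
  have key : W.det = Polynomial.C r * Yd.trailingCoeff ^ m := by
    rw [← htrailN, hdetN, trailingCoeff_mul, trailingCoeff_pow', htrailφ]
  -- Step 5: degrees in `t`: `1 = m · deg`, impossible for `m ≥ 2`.
  have hdeg : W.det.natDegree = m * Yd.trailingCoeff.natDegree := by
    rw [key, natDegree_C_mul hr0, natDegree_pow]
  rw [hWdeg] at hdeg
  have hdvd : m ∣ 1 := ⟨_, hdeg⟩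
  have := Nat.le_of_dvd one_pos hdvd
  omega

/-- **K-cw8 decided (NO)**: `cw₈` is not a degeneration of `⟨3,3,3⟩`. [this file] -/
theorem cw8_not_algDegeneratesTo_matMul3 :
    ¬ AlgDegeneratesTo (matMulTensor ℂ 3 3 3) (cwTensor ℂ 8) :=
  cwTensor_not_algDegeneratesTo_matMul 3 8 (by norm_num) (by norm_num)

/-- `cw₃` is not a degeneration of `⟨2,2,2⟩`. [this file] -/
theorem cw3_not_algDegeneratesTo_matMul2 :
    ¬ AlgDegeneratesTo (matMulTensor ℂ 2 2 2) (cwTensor ℂ 3) :=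
  cwTensor_not_algDegeneratesTo_matMul 2 3 (by norm_num) (by norm_num)

/-- `cw₁₅` is not a degeneration of `⟨4,4,4⟩`. [this file] -/
theorem cw15_not_algDegeneratesTo_matMul4 :
    ¬ AlgDegeneratesTo (matMulTensor ℂ 4 4 4) (cwTensor ℂ 15) :=
  cwTensor_not_algDegeneratesTo_matMul 4 15 (by norm_num) (by norm_num)

/-- A fortiori `cw_{m²-1}` is not a restriction of `⟨m,m,m⟩`. [this file] -/
theorem cwTensor_not_restrictsTo_matMul (m q : ℕ) (hm : 2 ≤ m) (hq : q + 1 = m * m) :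
    ¬ TensorRestrictsTo (matMulTensor ℂ m m m) (cwTensor ℂ q) :=
  fun hres => cwTensor_not_algDegeneratesTo_matMul m q hm hq hres.algDegeneratesTo

end Main

end

end Summit.MatrixMultiplication.MatrixMultiplication.Theorems.LittleCwNotMatMulDegeneration
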